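import Literature.Combinatorics.Optimization.LovaszSchrijverMatchingRank
import HarnessLib

/-!
# Blossom inequalities have `N₊`-rank `l`: the Lovász–Schrijver half of Stephen–Tunçel's upper bound (PROVED)

T. Stephen, L. Tunçel, *On a representation of the matching polytope via semidefinite liftings*,
Math. Oper. Res. **24** (1999) 1–7 [StephenTuncel1999] (held: `paper:doi-10-1287-moor-24-1-1`),
proof of Theorem 5.1, second part (pp. 6–7):

> "For the converse, we apply Lemma 1.5 of Lovász and Schrijver (1991) in an induction. We will
> prove that the inequality `x(E(S)) ≤ l x₀`, where `S ⊆ V` has cardinality `2l + 1`, is valid for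
> `Nˡ₊(P(2n+1))`. It can be checked by direct computation that the statement is true for `l = 1`.
> For `l = k + 1`, note that setting any edge variable `xⱼ = 1`, forces `xᵢ = 0` for all `i` such
> that `{i, j} ∈ Inc(2n+1)`. The resulting inequality is `x(E(S*)) ≤ k x₀`, where `S* ⊆ S` with
> `|S*| = 2k + 1`. By induction, the last inequality is valid for `Nᵏ₊(P(2n+1))` for any choice of
> `j ∈ E(S)`. Therefore, by Lemma 1.5 of Lovász and Schrijver (1991), `x(E(S)) ≤ (k+1) x₀`, is
> valid for `N^{k+1}₊(P(2n+1))` for any `S ⊆ V` such that `|S| = 2k + 3`. Note that the second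
> part of the above proof applies to any undirected graph `G`, yielding
> `N^{⌊|V|/2⌋}₊(P(G)) = P_I(G)`."

This file PROVES, for EVERY finite graph `G` (cone form of `LovaszSchrijverMatchingRank.lean`):

* `LovaszSchrijver.linear_valid_Nplus` — the Lovász–Schrijver lifting lemma used above ("Lemma
  1.5"), in the form the argument needs: if `a ≥ 0`, `β > 0` and `Σ aᵢxᵢ ≤ β x₀` holds on
  `K ∩ {xⱼ = x₀}` for every `j` with `aⱼ > 0`, then it holds on `N₊(K)` (from
  `0 ≤ wᵀ Y w = −β·(wᵀYe₀) + Σⱼ aⱼ·(wᵀYeⱼ)` for `w = (−β, a)`);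
* `blossom_valid_iterate_Nplus` — **`x(E(S)) ≤ l·x₀` is valid for `Nˡ₊(P(G))` whenever
  `|S| = 2l + 1`** (the displayed induction, started at `l = 0`);
* `iterate_Nplus_half_subset_blossomCone` — hence `N^{⌊|V|/2⌋}₊(P(G))` is contained in
  Edmonds' (homogenized) blossom description `{x ≥ 0, x(δ(v)) ≤ x₀, x(E(S)) ≤ ((|S|−1)/2) x₀}`;
* `matchingCone_subset_blossomCone` — the easy half of Edmonds' theorem (matchings satisfy the
  blossom inequalities), so `P_I(G) ⊆ N^{⌊|V|/2⌋}₊(P(G)) ⊆ blossomCone G`;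
* `StephenTuncel1999_rank_le_half_of_edmonds` — the named fact `StephenTuncel1999_rank_le_half`
  REDUCED to the hard half of Edmonds' matching polytope theorem (J. Edmonds, *Maximum matching
  and a polyhedron with 0,1-vertices*, 1965 [Edmonds1965]: `blossomCone G ⊆ P_I(G)`), which is
  not in the tree; no new named fact is introduced (the Edmonds direction enters as a hypothesis
  of the reduction theorem only).
-/

noncomputable section

open Matrix Finset

namespace Literature.Combinatorics.Optimization

namespace LovaszSchrijver

variable {ι : Type*} [Fintype ι]

/-- **Lovász–Schrijver's lifting lemma for `N₊`** ("Lemma 1.5 of Lovász and Schrijver (1991)" as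
used on p. 7): for `a ≥ 0` and `β > 0`, if `Σᵢ aᵢ xᵢ ≤ β x₀` holds on `K ∩ {xⱼ = x₀}` for every `j`
with `aⱼ > 0`, then it holds on `N₊(K)`. Proof: for `Y ∈ M₊(K)` with `Y e₀ = x` and
`w := (−β, a)`, `0 ≤ wᵀ Y w = −β (w·x) + Σⱼ aⱼ (w·Yeⱼ)` and `w·Yeⱼ ≤ 0` since
`Yeⱼ ∈ K ∩ {xⱼ = x₀}`. [cite: StephenTuncel1999, proof of Thm. 5.1 (p. 7)] [cite: LovaszSchrijver1991, Lemma 1.5] -/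
theorem linear_valid_Nplus (K : Set (Option ι → ℝ)) (a : ι → ℝ) (β : ℝ) (ha : ∀ i, 0 ≤ a i)
    (hβ : 0 < β)
    (hface : ∀ j, 0 < a j → ∀ y ∈ K, y (some j) = y none →
      ∑ i, a i * y (some i) ≤ β * y none)
    {x : Option ι → ℝ} (hx : x ∈ Nplus K) : ∑ i, a i * x (some i) ≤ β * x none := by
  obtain ⟨Y, hY, hYp, rfl⟩ := hx
  -- the functional `φ y = Σ aᵢ yᵢ − β y₀ = w · y`
  set w : Option ι → ℝ := fun o => o.elim (-β) a with hw
  have hφ : ∀ y : Option ι → ℝ, w ⬝ᵥ y = ∑ i, a i * y (some i) - β * y none := by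
    intro y
    simp only [dotProduct, Fintype.sum_option, w, Option.elim_none, Option.elim_some]
    ring
  -- rows `Y eⱼ` with `aⱼ > 0` satisfy `φ ≤ 0`
  have hrows : ∀ j, a j * (w ⬝ᵥ Y (some j)) ≤ 0 := by
    intro j
    rcases (ha j).eq_or_lt with h0 | hpos
    · rw [← h0]; simp
    · have hmem := hY.row_mem (some j)
      have hdiag : Y (some j) (some j) = Y (some j) none := by
        rw [hY.diag_eq j, hY.symm.apply (some j) none]
      have h := hface j hpos _ hmem hdiag
      rw [hφ]
      nlinarith
  -- positive semidefiniteness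
  have hpsd : 0 ≤ w ⬝ᵥ (Y *ᵥ w) := by
    simpa using hYp.dotProduct_mulVec_nonneg w
  have hexp : w ⬝ᵥ (Y *ᵥ w) = -β * (w ⬝ᵥ Y none) + ∑ j, a j * (w ⬝ᵥ Y (some j)) := by
    have h1 : ∀ p, (Y *ᵥ w) p = w ⬝ᵥ Y p := fun p => by
      rw [Matrix.mulVec, dotProduct_comm]
    have hwn : w none = -β := rfl
    have hws : ∀ j, w (some j) = a j := fun j => rfl
    rw [dotProduct]
    simp_rw [h1]
    rw [Fintype.sum_option, hwn]
    simp_rw [hws]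
  have hsum : ∑ j, a j * (w ⬝ᵥ Y (some j)) ≤ 0 := Finset.sum_nonpos fun j _ => hrows j
  have hx : w ⬝ᵥ Y none ≤ 0 := by nlinarith
  rw [hφ] at hx
  linarith

end LovaszSchrijver

namespace StephenTuncel1999

open LovaszSchrijver

variable {V : Type*} [Fintype V] [DecidableEq V] (G : SimpleGraph V) [DecidableRel G.Adj]

/-- The edges of `G` inside `S`: `E(S)`. [cite: StephenTuncel1999, §2 (p. 2: "E(S) refers to the set of edges in E with both endpoints in S")] -/
def edgesIn (S : Finset V) : Finset G.edgeSet :=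
  univ.filter fun e => ∀ v : V, v ∈ (e : Sym2 V) → v ∈ S

/-- `x(E(S))`. [cite: StephenTuncel1999, §2 (p. 2)] -/
def inSum (S : Finset V) (x : Option G.edgeSet → ℝ) : ℝ :=
  ∑ e ∈ edgesIn G S, x (some e)

/-- **Edmonds' blossom description, homogenized**: `P(G)` plus `x(E(S)) ≤ ((|S|−1)/2)·x₀` for
every odd `S` (p. 2: "`P_I(G) = {x ∈ P(G) : x(E(S)) ≤ (|S|−1)/2 for all S ⊆ V such that |S| is
odd}`", Edmonds 1965). [cite: StephenTuncel1999, §2 (p. 2)] [cite: Edmonds1965] -/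
def blossomCone : Set (Option G.edgeSet → ℝ) :=
  {x | x ∈ fracMatchingCone G ∧
    ∀ S : Finset V, Odd S.card → inSum G S x ≤ ((S.card - 1) / 2 : ℕ) * x none}

omit [Fintype V] in
/-- On `P(G) ∩ {x_j = x₀}` every other edge at an endpoint of `j` vanishes ("setting any edge
variable `xⱼ = 1` forces `xᵢ = 0` for all `i` such that `{i, j} ∈ Inc`", p. 7).
[cite: StephenTuncel1999, proof of Thm. 5.1 (p. 7)] -/
theorem eq_zero_of_mem_face [Fintype V] {x : Option G.edgeSet → ℝ} (hx : x ∈ fracMatchingCone G)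
    {j : G.edgeSet} (hj : x (some j) = x none) {u : V} (hu : u ∈ (j : Sym2 V))
    {e : G.edgeSet} (he : u ∈ (e : Sym2 V)) (hej : e ≠ j) : x (some e) = 0 := by
  have hdeg := hx.2 u
  -- split off `j` from the degree sum at `u`
  have hjmem : j ∈ univ.filter (fun e : G.edgeSet => u ∈ (e : Sym2 V)) :=
    mem_filter.mpr ⟨mem_univ _, hu⟩
  rw [← Finset.add_sum_erase _ _ hjmem, hj] at hdeg
  have hrest : ∑ e ∈ (univ.filter (fun e : G.edgeSet => u ∈ (e : Sym2 V))).erase j,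
      x (some e) ≤ 0 := by linarith
  have hnonneg : ∀ e ∈ (univ.filter (fun e : G.edgeSet => u ∈ (e : Sym2 V))).erase j,
      0 ≤ x (some e) := fun e _ => hx.1 (some e)
  have hzero := (Finset.sum_eq_zero_iff_of_nonneg hnonneg).mp
    (le_antisymm hrest (Finset.sum_nonneg hnonneg))
  exact hzero e (Finset.mem_erase.mpr ⟨hej, mem_filter.mpr ⟨mem_univ _, he⟩⟩)

/-- `x(E(S))` on the face `{x_j = x₀}`, `j = uv ⊆ S`: `x(E(S)) = x₀ + x(E(S ∖ {u,v}))`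
(the other edges of `E(S)` at `u` or `v` vanish). [cite: StephenTuncel1999, proof of Thm. 5.1 (p. 7)] -/
theorem inSum_face_eq {x : Option G.edgeSet → ℝ} (hx : x ∈ fracMatchingCone G)
    {S : Finset V} {j : G.edgeSet} (hjS : j ∈ edgesIn G S) (hj : x (some j) = x none) :
    inSum G S x = x none +
      inSum G (S.filter fun v => v ∉ (j : Sym2 V)) x := by
  classical
  unfold inSum
  -- split `E(S)` into the edges meeting `j` and the edges inside `S ∖ j`
  rw [← Finset.sum_filter_add_sum_filter_not (edgesIn G S)
    (fun e : G.edgeSet => ∃ v : V, v ∈ (e : Sym2 V) ∧ v ∈ (j : Sym2 V))]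
  congr 1
  · -- the edges of `E(S)` meeting `j`: only `j` contributes
    rw [Finset.sum_eq_single_of_mem j]
    · exact hj
    · refine mem_filter.mpr ⟨hjS, ?_⟩
      obtain ⟨u, hu⟩ : ∃ u : V, u ∈ (j : Sym2 V) := ⟨(j : Sym2 V).out.1, Sym2.out_fst_mem _⟩
      exact ⟨u, hu, hu⟩
    · intro e he hej
      obtain ⟨u, hue, huj⟩ := (mem_filter.mp he).2
      exact eq_zero_of_mem_face G hx hj huj hue hej
  · -- the edges of `E(S)` avoiding `j` are the edges of `E(S ∖ j)`
    refine Finset.sum_congr ?_ fun _ _ => rfl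
    ext e
    simp only [edgesIn, mem_filter, mem_univ, true_and, not_exists, not_and]
    constructor
    · rintro ⟨hS, hnj⟩ v hv
      exact ⟨hS v hv, hnj v hv⟩
    · intro h
      exact ⟨fun v hv => (h v hv).1, fun v hv => (h v hv).2⟩

omit [Fintype V] [DecidableRel G.Adj] in
/-- Removing the two endpoints of an edge `j ⊆ S` from `S` lowers `|S|` by `2`. [folklore] -/
private theorem card_filter_not_mem_edge {S : Finset V} {j : G.edgeSet}
    (hjS : ∀ v : V, v ∈ (j : Sym2 V) → v ∈ S) :
    (S.filter fun v => v ∉ (j : Sym2 V)).card + 2 = S.card := by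
  have h2 : (S.filter fun v => v ∈ (j : Sym2 V)).card = 2 := by
    obtain ⟨j, hj⟩ := j
    induction j using Sym2.ind with
    | h a b =>
      have hab : a ≠ b := G.ne_of_adj (by simpa using hj)
      have : S.filter (fun v => v ∈ s(a, b)) = {a, b} := by
        ext v
        simp only [mem_filter, Sym2.mem_iff, mem_insert, mem_singleton]
        constructor
        · exact fun h => h.2
        · intro h
          refine ⟨?_, h⟩
          rcases h with rfl | rfl
          · exact hjS _ (Sym2.mem_mk_left _ _)
          · exact hjS _ (Sym2.mem_mk_right _ _)
      rw [this, card_pair hab]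
  have := Finset.card_filter_add_card_filter_not (s := S) (fun v => v ∈ (j : Sym2 V))
  omega

/-- **The blossom inequality of an odd set of size `2l+1` is valid for `Nˡ₊(P(G))`** (for every
graph `G`; induction on `l` via the lifting lemma, exactly as on p. 7, started at `l = 0`).
[cite: StephenTuncel1999, proof of Thm. 5.1 (p. 7)] -/
theorem blossom_valid_iterate_Nplus (l : ℕ) :
    ∀ (S : Finset V), S.card = 2 * l + 1 →
      ∀ x ∈ Nplus^[l] (fracMatchingCone G), inSum G S x ≤ l * x none := by
  classical
  induction l with
  | zero =>
    intro S hS x _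
    -- `|S| = 1`: no edge inside `S`
    have hempty : edgesIn G S = ∅ := by
      rw [Finset.eq_empty_iff_forall_notMem]
      intro e he
      have hsub := (mem_filter.mp he).2
      obtain ⟨e, he'⟩ := e
      induction e using Sym2.ind with
      | h a b =>
        have hab : a ≠ b := G.ne_of_adj (by simpa using he')
        obtain ⟨v, hv⟩ := Finset.card_eq_one.mp hS
        have ha : a ∈ S := hsub a (Sym2.mem_mk_left _ _)
        have hb : b ∈ S := hsub b (Sym2.mem_mk_right _ _)
        rw [hv, mem_singleton] at ha hb
        exact hab (ha.trans hb.symm)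
    simp [inSum, hempty]
  | succ l ih =>
    intro S hS x hx
    rw [Function.iterate_succ_apply'] at hx
    -- apply the lifting lemma to `K = Nˡ₊(P(G))`, `a = 1_{E(S)}`, `β = l + 1`
    have key := linear_valid_Nplus (Nplus^[l] (fracMatchingCone G))
      (fun e : G.edgeSet => if e ∈ edgesIn G S then (1 : ℝ) else 0) (l + 1)
      (fun e => by split_ifs <;> norm_num) (by positivity) ?_ hx
    · -- rewrite the indicator sum as `x(E(S))`
      have hind : ∀ y : Option G.edgeSet → ℝ,
          ∑ e, (if e ∈ edgesIn G S then (1 : ℝ) else 0) * y (some e) = inSum G S y := by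
        intro y
        simp only [inSum, ite_mul, one_mul, zero_mul, Finset.sum_ite_mem, univ_inter]
      rw [hind] at key
      push_cast at key ⊢
      linarith
    · -- the face hypothesis: on `{y_j = y₀}`, `y(E(S)) = y₀ + y(E(S ∖ j)) ≤ y₀ + l y₀`
      intro j hj y hy hyj
      have hjS : j ∈ edgesIn G S := by
        by_contra h; simp [h] at hj
      have hyP : y ∈ fracMatchingCone G := iterate_Nplus_subset _ l hy
      have hind : ∑ e, (if e ∈ edgesIn G S then (1 : ℝ) else 0) * y (some e) = inSum G S y := by
        simp only [inSum, ite_mul, one_mul, zero_mul, Finset.sum_ite_mem, univ_inter]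
      rw [hind, inSum_face_eq G hyP hjS hyj]
      have hcard : (S.filter fun v => v ∉ (j : Sym2 V)).card = 2 * l + 1 := by
        have := card_filter_not_mem_edge G (S := S) (j := j) (mem_filter.mp hjS).2
        omega
      have hrec := ih _ hcard y hy
      linarith

/-- **`N^{⌊|V|/2⌋}₊(P(G))` satisfies every blossom inequality**, hence lies in Edmonds'
(homogenized) description. [cite: StephenTuncel1999, proof of Thm. 5.1 and the remark after it (p. 7)] -/
theorem iterate_Nplus_half_subset_blossomCone :
    Nplus^[Fintype.card V / 2] (fracMatchingCone G) ⊆ blossomCone G := by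
  intro x hx
  refine ⟨iterate_Nplus_subset _ _ hx, fun S hodd => ?_⟩
  obtain ⟨l, hl⟩ := hodd
  have hle : l ≤ Fintype.card V / 2 := by
    have := Finset.card_le_univ S
    omega
  have hx' : x ∈ Nplus^[l] (fracMatchingCone G) := iterate_Nplus_antitone _ hle hx
  have h := blossom_valid_iterate_Nplus G l S (by omega) x hx'
  rwa [hl, show (2 * l + 1 - 1) / 2 = l by omega]

/-- A 0-1 point of `P(G)` (i.e. `0` or the incidence vector of a matching) satisfies the blossom
inequalities: `x(E(S)) ≤ ((|S|−1)/2)·x₀` for odd `S` (the matching edges inside `S` are disjoint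
pairs of `S`). [cite: StephenTuncel1999, §2 (p. 2), Edmonds' description] [cite: Edmonds1965] -/
theorem inSum_le_of_zeroOne {x : Option G.edgeSet → ℝ} (hx : x ∈ fracMatchingCone G)
    (h01 : IsZeroOne x) (S : Finset V) (hodd : Odd S.card) :
    inSum G S x ≤ ((S.card - 1) / 2 : ℕ) * x none := by
  classical
  -- double count incidences inside `S`: `2·x(E(S)) ≤ Σ_{v ∈ S} x(δ(v)) ≤ |S|·x₀`
  have hcount : 2 * inSum G S x ≤ S.card * x none := by
    have h1 : 2 * inSum G S x =
        ∑ e ∈ edgesIn G S, ∑ v ∈ S.filter (fun v => v ∈ (e : Sym2 V)), x (some e) := by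
      unfold inSum
      rw [Finset.mul_sum]
      refine Finset.sum_congr rfl fun e he => ?_
      rw [Finset.sum_const]
      have : (S.filter fun v => v ∈ (e : Sym2 V)).card = 2 := by
        have h := card_filter_not_mem_edge G (S := S) (j := e) (mem_filter.mp he).2
        have := Finset.card_filter_add_card_filter_not (s := S)
          (fun v => v ∈ (e : Sym2 V))
        omega
      rw [this]
      simp [two_mul]
    have h2 : ∑ e ∈ edgesIn G S, ∑ v ∈ S.filter (fun v => v ∈ (e : Sym2 V)), x (some e) ≤
        ∑ v ∈ S, ∑ e ∈ univ.filter (fun e : G.edgeSet => v ∈ (e : Sym2 V)), x (some e) := by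
      rw [Finset.sum_comm' (t' := S)
        (s' := fun v => (edgesIn G S).filter (fun e : G.edgeSet => v ∈ (e : Sym2 V)))
        (h := fun e v => by
          simp only [mem_filter]
          tauto)]
      refine Finset.sum_le_sum fun v _ => ?_
      refine Finset.sum_le_sum_of_subset_of_nonneg ?_ fun e _ _ => hx.1 (some e)
      intro e he
      exact mem_filter.mpr ⟨mem_univ _, (mem_filter.mp he).2⟩
    have h3 : ∑ v ∈ S, ∑ e ∈ univ.filter (fun e : G.edgeSet => v ∈ (e : Sym2 V)), x (some e) ≤
        ∑ _v ∈ S, x none := Finset.sum_le_sum fun v _ => hx.2 v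
    rw [Finset.sum_const, nsmul_eq_mul] at h3
    linarith
  -- `x(E(S))` is a natural number `m` and `x₀ ∈ {0, 1}`
  obtain ⟨m, hm⟩ : ∃ m : ℕ, inSum G S x = m := by
    refine ⟨((edgesIn G S).filter fun e => x (some e) = 1).card, ?_⟩
    unfold inSum
    rw [← Finset.sum_boole]
    refine Finset.sum_congr rfl fun e _ => ?_
    rcases h01 (some e) with h | h <;> simp [h]
  rw [hm] at hcount ⊢
  rcases h01 none with h0 | h1
  · rw [h0] at hcount ⊢
    have : (m : ℝ) ≤ 0 := by linarith
    have hm0 : m = 0 := by exact_mod_cast le_antisymm this (Nat.cast_nonneg m)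
    simp [hm0]
  · rw [h1, mul_one] at hcount ⊢
    obtain ⟨l, hl⟩ := hodd
    rw [hl] at hcount ⊢
    have : 2 * m ≤ 2 * l + 1 := by exact_mod_cast hcount
    rw [show (2 * l + 1 - 1) / 2 = l by omega]
    exact_mod_cast (show m ≤ l by omega)

/-- **The easy half of Edmonds' theorem: `P_I(G) ⊆ blossomCone G`.**
[cite: StephenTuncel1999, §2 (p. 2)] [cite: Edmonds1965] -/
theorem matchingCone_subset_blossomCone : matchingCone G ⊆ blossomCone G := by
  classical
  intro x hx
  refine ⟨?_, fun S hodd => ?_⟩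
  · exact matchingCone_subset_iterate_Nplus G 0 hx
  · unfold matchingCone integralCone at hx
    refine Submodule.span_induction (p := fun y _ => inSum G S y ≤ ((S.card - 1) / 2 : ℕ) * y none)
      ?_ ?_ ?_ ?_ hx
    · exact fun v hv => inSum_le_of_zeroOne G hv.1 hv.2 S hodd
    · simp [inSum]
    · intro y z _ _ hy hz
      have e1 : inSum G S (y + z) = inSum G S y + inSum G S z := by
        simp [inSum, Finset.sum_add_distrib]
      rw [e1]
      simpa [mul_add] using add_le_add hy hz
    · rintro ⟨c, hc⟩ y _ hy
      have h := mul_le_mul_of_nonneg_left hy hc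
      have e1 : inSum G S (((⟨c, hc⟩ : {c : ℝ // 0 ≤ c}) • y)) = c * inSum G S y := by
        unfold inSum; rw [Finset.mul_sum]; rfl
      have e2 : ((⟨c, hc⟩ : {c : ℝ // 0 ≤ c}) • y) none = c * y none := rfl
      rw [e1, e2]
      linarith

/-- **`StephenTuncel1999_rank_le_half` reduced to Edmonds' matching polytope theorem**: if the
blossom description is contained in the cone over the matchings for every graph (Edmonds 1965,
hard direction; not in the tree), then `N^{⌊|V|/2⌋}₊(P(G)) = P_I(G)` for every graph.
[cite: StephenTuncel1999, §5, remark after the proof of Thm. 5.1 (p. 7)] [cite: Edmonds1965] -/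
theorem StephenTuncel1999_rank_le_half_of_edmonds
    (hE : ∀ (m : ℕ) (G : SimpleGraph (Fin m)) [DecidableRel G.Adj], blossomCone G ⊆ matchingCone G) :
    StephenTuncel1999_rank_le_half := by
  intro m G _
  refine Set.Subset.antisymm ?_ (matchingCone_subset_iterate_Nplus G _)
  have h := iterate_Nplus_half_subset_blossomCone G
  rw [Fintype.card_fin] at h
  exact h.trans (hE m G)

end StephenTuncel1999

end Literature.Combinatorics.Optimization
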